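import Summits.CriticalPhenomena.PercolationContinuityZ3.Theorems.Transplant.FKConnectivityAllQAntipodalX2WordsSigmaPhi
import HarnessLib

/-!
# Connectivity correlation inequalities for `φ_{w,q}` — σ-WORDS, file 15: WORD-HALL for every σ-word (gen 12's word problem,
# memo g12 §4.2, g13 Theorem A lifted)

Helper file (`--supports stmt-CriticalPhenomena-4575`), FK sub-lane `prim-bschramm-fk-2` (gen 13); builds on p205010 (kernel
theorem, internal audit signed; external expert review pending).  Pure finite combinatorics (memo `bschramm/FROM-fk-2-g13-WORD-HALL.md`
§1.3 and §7.2: the LIFT of Theorem A from type words to gen 12's σ-words).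
`zipBack` re-inserts a processed non-inert subsequence into the inert skeleton of a word; `sigmaPhi w := zipBack w (sPhi (nonInertPart w))`.
**`sigma_wordHall`**: for every loser σ-word `w` (any spine shape, any length): `sigmaPhi w` is a WINNER with the same number of particle
runs (so the same `corr`), it differs from `w` only by flips `01 → 10` of free letters, and `sigmaPhi` is injective on losers.  This is
WORD-HALL(o) of memo g12 §4.2 for all shapes `o`; by memo g13 §5.1 (one application of Theorem U `FK.apUpc_nonneg_of_isTTSP` per flipped
part along the spine) it yields `apX2 ≥ 0`, i.e. the node `FK.ApX2Pos` — the remaining (graph-side) formalisation F5.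
[cite: Grimmett2006, §3.9 (p. 63)]
-/

namespace Summit.CriticalPhenomena.PercolationContinuityZ3.Theorems

namespace FK

namespace X2Word

/-! ### General σ-words: the inert letters are put back in place -/

section Unmask

/-- Re-insert a processed non-inert subsequence into the inert skeleton of `w`. [folklore] -/
def zipBack : List SLetter → List SLetter → List SLetter
  | [], _ => []
  | l :: w, v => if isInert l then l :: zipBack w v else
      match v with
      | [] => []
      | a :: v' => a :: zipBack w v'

/-- The non-inert subsequence. [folklore] -/
def nonInertPart (w : List SLetter) : List SLetter := w.filter fun l => !isInert l

/-- **The matching on σ-words (gen 12's word model):** flip the free letters of the blocks outside the RULE-N window of the type word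
of the non-inert subsequence; inert letters stay in place. [folklore] -/
def sigmaPhi (w : List SLetter) : List SLetter := zipBack w (sPhi (nonInertPart w))

/-- The letters of the non-inert subsequence are non-inert. [folklore] -/
theorem nonInertPart_spec (w : List SLetter) : ∀ l ∈ nonInertPart w, isInert l = false := by
  intro l hl; unfold nonInertPart at hl; have := List.of_mem_filter hl; simpa using this

/-- `nonInertPart` of a `cons`. [folklore] -/
theorem nonInertPart_cons (l : SLetter) (w : List SLetter) :
    nonInertPart (l :: w) = if isInert l then nonInertPart w else l :: nonInertPart w := by
  unfold nonInertPart; rw [List.filter_cons]; cases isInert l <;> simp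

/-- `zipBack` on an inert head. [folklore] -/
theorem zipBack_cons_inert {l : SLetter} (hl : isInert l = true) (w v : List SLetter) :
    zipBack (l :: w) v = l :: zipBack w v := by simp [zipBack, hl]

/-- `zipBack` on a non-inert head. [folklore] -/
theorem zipBack_cons_nonInert {l : SLetter} (hl : isInert l = false) (w : List SLetter) (a : SLetter) (v : List SLetter) :
    zipBack (l :: w) (a :: v) = a :: zipBack w v := by simp [zipBack, hl]

/-- `zipBack` on a non-inert head with nothing left to insert. [folklore] -/
theorem zipBack_cons_nonInert_nil {l : SLetter} (hl : isInert l = false) (w : List SLetter) :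
    zipBack (l :: w) [] = [] := by simp [zipBack, hl]

/-- Putting the word's own non-inert subsequence back gives the word. [folklore] -/
theorem zipBack_self (w : List SLetter) : zipBack w (nonInertPart w) = w := by
  induction w with
  | nil => rfl
  | cons l w ih =>
    rw [nonInertPart_cons]
    cases hl : isInert l with
    | true => rw [if_pos rfl, zipBack_cons_inert hl, ih]
    | false => simp only [Bool.false_eq_true, if_false]; rw [zipBack_cons_nonInert hl, ih]

/-- The non-inert subsequence of a zipped-back word. [folklore] -/
theorem nonInertPart_zipBack (w v : List SLetter) (hv : ∀ l ∈ v, isInert l = false)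
    (hlen : v.length = (nonInertPart w).length) : nonInertPart (zipBack w v) = v := by
  induction w generalizing v with
  | nil =>
    cases v with
    | nil => rfl
    | cons a v => simp [nonInertPart] at hlen
  | cons l w ih =>
    rw [nonInertPart_cons] at hlen
    cases hl : isInert l with
    | true =>
      rw [hl, if_pos rfl] at hlen
      rw [zipBack_cons_inert hl, nonInertPart_cons, hl, if_pos rfl, ih v hv hlen]
    | false =>
      rw [hl] at hlen; simp only [Bool.false_eq_true, if_false, List.length_cons] at hlen
      cases v with
      | nil => simp at hlen
      | cons a v =>
        rw [zipBack_cons_nonInert hl, nonInertPart_cons, hv a (by simp)]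
        simp only [Bool.false_eq_true, if_false]
        rw [ih v (fun l' hl' => hv l' (List.mem_cons_of_mem _ hl')) (by simpa using hlen)]

/-- The inert skeleton of a zipped-back word is that of the original word. [folklore] -/
theorem zipBack_skeleton (w v : List SLetter) (hv : ∀ l ∈ v, isInert l = false) (hlen : v.length = (nonInertPart w).length) :
    (zipBack w v).map (fun l => if isInert l then some l else none) = w.map (fun l => if isInert l then some l else none) := by
  induction w generalizing v with
  | nil => rfl
  | cons l w ih =>
    rw [nonInertPart_cons] at hlen
    cases hl : isInert l with
    | true =>
      rw [hl, if_pos rfl] at hlen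
      rw [zipBack_cons_inert hl, List.map_cons, List.map_cons, ih v hv hlen]
    | false =>
      rw [hl] at hlen; simp only [Bool.false_eq_true, if_false, List.length_cons] at hlen
      cases v with
      | nil => simp at hlen
      | cons a v =>
        rw [zipBack_cons_nonInert hl, List.map_cons, List.map_cons, hv a (by simp), hl,
          ih v (fun l' hl' => hv l' (List.mem_cons_of_mem _ hl')) (by simpa using hlen)]
        simp

/-- A word is determined by its inert skeleton and its non-inert subsequence. [folklore] -/
theorem zipBack_eq_of_skeleton (w w' v : List SLetter)
    (h : w.map (fun l => if isInert l then some l else none) = w'.map (fun l => if isInert l then some l else none)) :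
    zipBack w v = zipBack w' v := by
  induction w generalizing w' v with
  | nil => cases w' with
    | nil => rfl
    | cons _ _ => simp at h
  | cons l w ih =>
    cases w' with
    | nil => simp at h
    | cons l' w' =>
      simp only [List.map_cons, List.cons.injEq] at h
      obtain ⟨h1, h2⟩ := h
      cases hl : isInert l with
      | true =>
        cases hl' : isInert l' with
        | false => rw [hl, hl'] at h1; simp at h1
        | true =>
          rw [hl, hl'] at h1
          have : l = l' := by simpa using h1
          subst this
          rw [zipBack_cons_inert hl, zipBack_cons_inert hl, ih w' v h2]
      | false =>
        cases hl' : isInert l' with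
        | true => rw [hl, hl'] at h1; simp at h1
        | false =>
          cases v with
          | nil => rw [zipBack_cons_nonInert_nil hl, zipBack_cons_nonInert_nil hl']
          | cons a v => rw [zipBack_cons_nonInert hl, zipBack_cons_nonInert hl', ih w' v h2]

/-- `zipBack` relates letterwise: inert letters to themselves, the others as `v` relates to the non-inert subsequence. [folklore] -/
theorem forall₂_zipBack {R : SLetter → SLetter → Prop} (hR : ∀ l, isInert l = true → R l l) (w v : List SLetter)
    (h : List.Forall₂ R (nonInertPart w) v) : List.Forall₂ R w (zipBack w v) := by
  induction w generalizing v with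
  | nil => exact List.Forall₂.nil
  | cons l w ih =>
    rw [nonInertPart_cons] at h
    cases hl : isInert l with
    | true =>
      rw [hl, if_pos rfl] at h
      rw [zipBack_cons_inert hl]
      exact List.Forall₂.cons (hR l hl) (ih v h)
    | false =>
      rw [hl] at h; simp only [Bool.false_eq_true, if_false] at h
      cases v with
      | nil => exact absurd h (by intro hc; cases hc)
      | cons a v =>
        rw [zipBack_cons_nonInert hl]
        cases h with
        | cons hab hrest => exact List.Forall₂.cons hab (ih v hrest)

end Unmask

/-! ### WORD-HALL for σ-words (gen 12's word problem, memo g12 §4.2 / g13 Theorem A) -/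

section SigmaWordHall

/-- Rows of a zipped-back word are those of the inserted subsequence. [folklore] -/
theorem sRowA_zipBack (w v : List SLetter) (hv : ∀ l ∈ v, isInert l = false) (hlen : v.length = (nonInertPart w).length) :
    sRowA (zipBack w v) = sRowA v := by
  rw [← sRowA_filter_inert, ← nonInertPart, nonInertPart_zipBack w v hv hlen]

/-- Row `B` analogue of `sRowA_zipBack`. [folklore] -/
theorem sRowB_zipBack (w v : List SLetter) (hv : ∀ l ∈ v, isInert l = false) (hlen : v.length = (nonInertPart w).length) :
    sRowB (zipBack w v) = sRowB v := by
  rw [← sRowB_filter_inert, ← nonInertPart, nonInertPart_zipBack w v hv hlen]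

/-- The matched word of the non-inert part has the right length. [folklore] -/
theorem length_sPhi (v : List SLetter) : (sPhi v).length = v.length := by
  have := (sPhi_letterwise v).length_eq
  exact this.symm

/-- The loser test only sees the non-inert subsequence. [folklore] -/
theorem sIsLoser_nonInertPart (w : List SLetter) : sIsLoser (nonInertPart w) = sIsLoser w := by
  unfold sIsLoser nonInertPart; rw [sRowA_filter_inert, sRowB_filter_inert]

/-- **WORD-HALL (σ-words).**  For every loser `w` of gen 12's word model: `sigmaPhi w` is a WINNER with the same number of particle
runs (hence the same `corr`), it differs from `w` only by flips `01 → 10` of free letters, and `sigmaPhi` is injective on losers.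
This is the word-level statement of memo g12 §4.2 whose consequence (memo g13 §5.1, by one application of Theorem U per flipped
part) is `FK.ApX2Pos`. [folklore] -/
theorem sigma_wordHall (w : List SLetter) (hw : sIsLoser w = true) :
    sIsWinner (sigmaPhi w) = true ∧ sRuns (sigmaPhi w) = sRuns w ∧
    List.Forall₂ (fun a b : SLetter => b = a ∨ (a.2 = (false, true) ∧ b = (a.1, true, false))) w (sigmaPhi w) ∧
    (∀ w', sIsLoser w' = true → sigmaPhi w' = sigmaPhi w → w' = w) := by
  have hv := nonInertPart_spec w
  have hx : sIsLoser (nonInertPart w) = true := by rw [sIsLoser_nonInertPart]; exact hw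
  have hv' := sPhi_nonInert (v := nonInertPart w) hv
  have hlen : (sPhi (nonInertPart w)).length = (nonInertPart w).length := length_sPhi _
  obtain ⟨hwin, hruns⟩ := sPhi_winner hv hx
  refine ⟨?_, ?_, ?_, ?_⟩
  · unfold sigmaPhi sIsWinner at *
    rw [sRowA_zipBack _ _ hv' hlen, sRowB_zipBack _ _ hv' hlen]; exact hwin
  · unfold sigmaPhi sRuns at *
    rw [sRowA_zipBack _ _ hv' hlen, sRowB_zipBack _ _ hv' hlen, hruns, ← sRowA_filter_inert w, ← sRowB_filter_inert w]; rfl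
  · unfold sigmaPhi
    apply forall₂_zipBack (fun l _ => Or.inl rfl)
    exact sPhi_letterwise _
  · intro w' hw' heq
    have hvv := nonInertPart_spec w'
    have hx' : sIsLoser (nonInertPart w') = true := by rw [sIsLoser_nonInertPart]; exact hw'
    have hlen' : (sPhi (nonInertPart w')).length = (nonInertPart w').length := length_sPhi _
    unfold sigmaPhi at heq
    -- same skeleton
    have hsk := zipBack_skeleton w' _ (sPhi_nonInert (v := nonInertPart w') hvv) hlen'
    rw [heq, zipBack_skeleton w _ hv' hlen] at hsk
    -- same non-inert part after matching, hence before
    have hni : sPhi (nonInertPart w') = sPhi (nonInertPart w) := by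
      have e1 := nonInertPart_zipBack w' _ (sPhi_nonInert (v := nonInertPart w') hvv) hlen'
      have e2 := nonInertPart_zipBack w _ hv' hlen
      rw [← e1, ← e2, heq]
    have hparts : nonInertPart w' = nonInertPart w := sPhi_injective hvv hv hx' hx hni
    calc w' = zipBack w' (nonInertPart w') := (zipBack_self w').symm
      _ = zipBack w (nonInertPart w') := zipBack_eq_of_skeleton _ _ _ hsk.symm
      _ = w := by rw [hparts, zipBack_self]

end SigmaWordHall

end X2Word

end FK

end Summit.CriticalPhenomena.PercolationContinuityZ3.Theorems
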